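import Summits.KontsevichZagierPeriods.Zeta5Search.Barrier.ConeGammaCuspPeriodRayValue

/-!
# ζ(5) search — BARRIER: THE UNIT-SPREAD SECTION OF A CHAMBER — every chamber functional, of either sign, is extremal at a NORMALISED RAY

HONEST FRAMING (cell `pub-zeta5`): systematic search; no irrationality claim unless kernel-certified. MODEL objects
under Brown–Zudilin's (28)+(30) accounting ([BZ22] = arXiv:2210.03391; (28) observed, not proved); nothing here is a
statement about `ζ(5)`, any `γ` of record, the cone's supremum (C2 OPEN) or the value / sign of the cusp slope or of
a chamber functional at a named direction (DATA of the cell); no ray or value at a named direction enters the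
kernel; S-E stays CONJECTURED; records in print UNMOVED. Prover P2 g36, item «THE GLOBAL ASCENT MODULUS», file (1)
(theorems only; pure linear geometry of the 28 rates `r_k(δ) = φ_k(δ)/h_k(a)` on `ℝ⁸`, no period data).

THE POINT. P2 g35's `exists_ray_pos_of_pos` maximises a chamber functional `Σ_k W_k·r_k` (`Σ_k W_k = 0`) over the
closed chamber of a generic reference cut to rate spread `≤ 1` — a polytope containing the apex `0`, so its maximum is
`≥ 0` and sits at a RAY only when it is positive. For the SIGNED question (how negative is a descending chamber? what is
the best constant `λ` in `Σ_k W_k·r_k(δ) ≤ λ·spread(δ)` on the chamber?) one maximises over the UNIT-SPREAD SECTION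
`{δ ∈ C(δ₀) : r_m(δ) = 0, r_M(δ) = 1}` (`m` / `M` the slowest / fastest form of `δ₀`) — a pointed polytope NOT containing
the apex, whose vertices are exactly the NORMALISED RAYS of the chamber (rates in `[0, 1]`, one rate `0`, one rate `1`,
rigid tie pattern):
* **`exists_normalised_ray_max_section`** — for a generic `δ₀` and ANY weights with `Σ_k W_k = 0` there is a normalised
  RAY `x` of the closed chamber of `δ₀` with `Σ_k W_k·r_k(y) ≤ (Σ_k W_k·r_k(x))·(r_M(y) − r_m(y))` for EVERY `y` in the
  closed chamber and every slowest / fastest pair `(m, M)` of `y` — the signed chamber value is attained at a ray,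
  whatever its sign (the tree's Schrijver §8.5 (23) `BasicOptimumSolution.exists_optimum_determined_by_tight_rows` on
  the section, attainment by `LPDuality.exists_isMaxOn_of_forall_le`); with `W = 0`: every chamber HAS a normalised ray;
* **`eq_of_normalised_of_same_order`** — a normalised ray is the ONLY normalised displacement with its strict order
  pattern (`r_k < r_l`): two rays of one tie type differ by the gauge `u•x + t•s(a)`, the order fixes `u > 0`, the
  normalisation fixes `u = 1`, `t = 0`;
* **`exists_finset_normalised_rays`** — hence THE NORMALISED RAYS FORM A FINITE SET (they inject into the `2^(28·28)`
  order patterns; no count is claimed) — the index set of file (2)'s global maximum.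
NOT here: the cusp slope (file (2) takes `W =` the chamber weights of the period pattern function), any ray or value at
a named direction, any count.
-/

noncomputable section

open Set MeasureTheory Finset Matrix
open scoped Topology

namespace Summit.KontsevichZagierPeriods.Zeta5Search.Barrier.ConeGamma

/-! ### The signed chamber value sits at a normalised ray -/

/-- **EVERY CHAMBER FUNCTIONAL IS EXTREMAL AT A NORMALISED RAY OF ITS CHAMBER — EITHER SIGN** (Schrijver 1986 §8.5 (23)
via the tree's `BasicOptimumSolution.exists_optimum_determined_by_tight_rows`, attainment by
`LPDuality.exists_isMaxOn_of_forall_le`). All 28 forms of `a` positive, `δ₀` a generic reference, `W` any weights with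
`Σ_k W_k = 0`. There is a displacement `x` in the closed chamber of `δ₀` (`x` refined by `δ₀`), NORMALISED — rates in
`[0, 1]`, one rate `0` and one rate `1` — which is a RAY of the rate arrangement (two distinct rates, rigid tie pattern:
every tie-preserving displacement lies in `span{x, s(a)}`), such that for EVERY `y` in the closed chamber and every pair
`(m, M)` of a slowest and a fastest form of `y`: `Σ_k W_k·r_k(y) ≤ (Σ_k W_k·r_k(x))·(r_M(y) − r_m(y))` — the best
constant in «functional `≤ λ·`spread» on the chamber is the value at a normalised ray, WHATEVER ITS SIGN. PROOF SHAPE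
(re-derivable by hand): maximise over the section `{r_k ≤ r_l (ρ₀ k < ρ₀ l), r_{m₀} = 0, r_{M₀} = 1}` (`m₀` / `M₀` the
slowest / fastest form of `δ₀`, which bound every rate on the closed chamber); it is POINTED (a `d` killed by all rows has
all 28 rates equal and `r_{m₀}(d) = 0`, and the 28 forms separate `ℝ⁸`), non-empty (the normalised `δ₀`) and the
objective is bounded (rates in `[0, 1]`); at a basic optimum «the tight rows determine `x`» reads: a tie-preserving `d`
minus `(r_{M₀}(d) − r_{m₀}(d))•x + r_{m₀}(d)•s(a)` solves the tight homogeneous system, hence vanishes; a `y` of positive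
spread `s` is compared through `s⁻¹•y − (r_{m₀}(y)/s)•s(a)`, which lies on the section (`Σ W = 0` absorbs the shift), and
a `y` of spread `0` is radial with value `0`. With `W = 0` the statement says: every chamber contains a normalised ray.
No instance at a named direction. -/
theorem exists_normalised_ray_max_section {a : Dir} (hpos : ∀ k, 0 < h28 a k) {δ₀ : Fin 8 → ℝ}
    (hgen : ∀ k l : Fin 28, k ≠ l → phiForm δ₀ k / h28 a k ≠ phiForm δ₀ l / h28 a l)
    {W : Fin 28 → ℝ} (hW : ∑ k, W k = 0) :
    ∃ x : Fin 8 → ℝ, (∀ k l : Fin 28, phiForm x k / h28 a k < phiForm x l / h28 a l →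
        phiForm δ₀ k / h28 a k < phiForm δ₀ l / h28 a l) ∧
      (∀ k, 0 ≤ phiForm x k / h28 a k ∧ phiForm x k / h28 a k ≤ 1) ∧
      (∃ k l, phiForm x k / h28 a k = 0 ∧ phiForm x l / h28 a l = 1) ∧
      ((∃ k l, phiForm x k / h28 a k ≠ phiForm x l / h28 a l) ∧
        ∀ d : Fin 8 → ℝ, (∀ k l, phiForm x k / h28 a k = phiForm x l / h28 a l →
          phiForm d k / h28 a k = phiForm d l / h28 a l) → ∃ u t : ℝ, d = u • x + t • sParam a) ∧
      ∀ y : Fin 8 → ℝ, (∀ k l : Fin 28, phiForm y k / h28 a k < phiForm y l / h28 a l →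
          phiForm δ₀ k / h28 a k < phiForm δ₀ l / h28 a l) →
        ∀ m M : Fin 28, (∀ k, phiForm y m / h28 a m ≤ phiForm y k / h28 a k ∧
            phiForm y k / h28 a k ≤ phiForm y M / h28 a M) →
          ∑ k, W k * (phiForm y k / h28 a k) ≤
            (∑ k, W k * (phiForm x k / h28 a k)) * (phiForm y M / h28 a M - phiForm y m / h28 a m) := by
  classical
  -- rates as dot products with fixed vectors
  obtain ⟨n, hn⟩ : ∃ n : Fin 28 → Fin 8 → ℝ, ∀ k p, n k p = phiForm (Pi.single p (1 : ℝ)) k / h28 a k :=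
    ⟨_, fun _ _ => rfl⟩
  have hrate : ∀ (y : Fin 8 → ℝ) k, n k ⬝ᵥ y = phiForm y k / h28 a k := fun y k => by
    rw [rate_eq_sum_coord a y k, dotProduct]
    exact Finset.sum_congr rfl fun p _ => by rw [hn, mul_comm]
  -- the objective vector
  obtain ⟨c, hc⟩ : ∃ c : Fin 8 → ℝ, ∀ p, c p = ∑ k, W k * (phiForm (Pi.single p (1 : ℝ)) k / h28 a k) :=
    ⟨_, fun _ => rfl⟩
  have hobj : ∀ y : Fin 8 → ℝ, c ⬝ᵥ y = ∑ k, W k * (phiForm y k / h28 a k) := fun y => by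
    rw [sum_mul_rate_eq_sum_coord a W y, dotProduct]
    exact Finset.sum_congr rfl fun p _ => by rw [hc, mul_comm]
  -- the value is gauge invariant (`Σ W = 0`) and homogeneous
  have hval : ∀ (y : Fin 8 → ℝ) (u t : ℝ), ∑ k, W k * (phiForm (u • y + t • sParam a) k / h28 a k) =
      u * ∑ k, W k * (phiForm y k / h28 a k) := fun y u t => by
    have e : ∀ k, W k * (phiForm (u • y + t • sParam a) k / h28 a k) =
        u * (W k * (phiForm y k / h28 a k)) + t * W k := fun k => by
      rw [rate_smul_add_smul_sParam hpos]; ring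
    simp_rw [e]
    rw [Finset.sum_add_distrib, ← Finset.mul_sum, ← Finset.mul_sum, hW, mul_zero, add_zero]
  -- the slowest and the fastest form of `δ₀`
  obtain ⟨m, -, hm⟩ := Finset.exists_min_image Finset.univ (fun k => phiForm δ₀ k / h28 a k) Finset.univ_nonempty
  obtain ⟨M, -, hM⟩ := Finset.exists_max_image Finset.univ (fun k => phiForm δ₀ k / h28 a k) Finset.univ_nonempty
  have hm' : ∀ k, k ≠ m → phiForm δ₀ m / h28 a m < phiForm δ₀ k / h28 a k := fun k hk =>
    lt_of_le_of_ne (hm k (Finset.mem_univ _)) (hgen m k (Ne.symm hk))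
  have hM' : ∀ k, k ≠ M → phiForm δ₀ k / h28 a k < phiForm δ₀ M / h28 a M := fun k hk =>
    lt_of_le_of_ne (hM k (Finset.mem_univ _)) (hgen k M hk)
  have hmM : m ≠ M := by
    intro h
    obtain ⟨k₀, hk₀⟩ : ∃ k₀ : Fin 28, k₀ ≠ m := ⟨if m = 0 then 1 else 0, by split_ifs with h0 <;> simp [h0, Ne.symm]⟩
    exact lt_asymm (hm' k₀ hk₀) (h ▸ hM' k₀ (h ▸ hk₀))
  have hmM' : phiForm δ₀ m / h28 a m < phiForm δ₀ M / h28 a M := hm' M (Ne.symm hmM)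
  -- on the closed chamber: `r_m ≤ r_k ≤ r_M`
  have hsand : ∀ y : Fin 8 → ℝ, (∀ k l : Fin 28, phiForm δ₀ k / h28 a k < phiForm δ₀ l / h28 a l →
      phiForm y k / h28 a k ≤ phiForm y l / h28 a l) → ∀ k,
      phiForm y m / h28 a m ≤ phiForm y k / h28 a k ∧ phiForm y k / h28 a k ≤ phiForm y M / h28 a M := by
    intro y hy k
    refine ⟨?_, ?_⟩
    · by_cases hk : k = m; · rw [hk]
      exact hy m k (hm' k hk)
    · by_cases hk : k = M; · rw [hk]
      exact hy k M (hM' k hk)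
  -- the rows of the section `{gaps ≥ 0, r_m = 0, r_M − r_m = 1}`
  obtain ⟨arow, harow⟩ : ∃ arow : (Fin 28 × Fin 28) ⊕ Fin 4 → Fin 8 → ℝ, arow =
      Sum.elim (fun kl : Fin 28 × Fin 28 =>
        if phiForm δ₀ kl.1 / h28 a kl.1 < phiForm δ₀ kl.2 / h28 a kl.2 then n kl.1 - n kl.2 else 0)
        ![n m, -n m, n M - n m, n m - n M] := ⟨_, rfl⟩
  obtain ⟨brow, hbrow⟩ : ∃ brow : (Fin 28 × Fin 28) ⊕ Fin 4 → ℝ, brow = Sum.elim (fun _ => 0) ![0, 0, 1, -1] :=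
    ⟨_, rfl⟩
  -- feasibility, read both ways
  have feas_of : ∀ y : Fin 8 → ℝ, (∀ k l : Fin 28, phiForm δ₀ k / h28 a k < phiForm δ₀ l / h28 a l →
      phiForm y k / h28 a k ≤ phiForm y l / h28 a l) → phiForm y m / h28 a m = 0 → phiForm y M / h28 a M = 1 →
      ∀ i, arow i ⬝ᵥ y ≤ brow i := by
    intro y hy hym hyM i
    rcases i with ⟨k, l⟩ | j
    · simp only [harow, hbrow, Sum.elim_inl]
      split_ifs with hkl
      · rw [sub_dotProduct, hrate, hrate, sub_nonpos]; exact hy k l hkl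
      · rw [zero_dotProduct]
    · fin_cases j
      · simp [harow, hbrow, hrate, hym]
      · simp [harow, hbrow, neg_dotProduct, hrate, hym]
      · simp [harow, hbrow, sub_dotProduct, hrate, hym, hyM]
      · simp [harow, hbrow, sub_dotProduct, hrate, hym, hyM]
  have of_feas : ∀ y : Fin 8 → ℝ, (∀ i, arow i ⬝ᵥ y ≤ brow i) →
      (∀ k l : Fin 28, phiForm δ₀ k / h28 a k < phiForm δ₀ l / h28 a l →
        phiForm y k / h28 a k ≤ phiForm y l / h28 a l) ∧ phiForm y m / h28 a m = 0 ∧ phiForm y M / h28 a M = 1 := by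
    intro y hy
    have h0 := hy (Sum.inr 0)
    have h1 := hy (Sum.inr 1)
    have h2 := hy (Sum.inr 2)
    have h3 := hy (Sum.inr 3)
    simp only [harow, hbrow, Sum.elim_inr, Matrix.cons_val_zero, Matrix.cons_val_one, Matrix.cons_val_two,
      Matrix.cons_val_three, Matrix.tail_cons, Matrix.head_cons, neg_dotProduct, sub_dotProduct, hrate]
      at h0 h1 h2 h3
    have hym : phiForm y m / h28 a m = 0 := le_antisymm h0 (by linarith)
    refine ⟨fun k l hkl => ?_, hym, by linarith⟩
    have h := hy (Sum.inl (k, l))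
    simp only [harow, hbrow, Sum.elim_inl, if_pos hkl, sub_dotProduct, hrate] at h
    linarith
  -- the section is pointed
  have hA : ∀ d : Fin 8 → ℝ, (∀ i, arow i ⬝ᵥ d = 0) → d = 0 := by
    intro d hd
    have hdm : phiForm d m / h28 a m = 0 := by
      simpa only [harow, Sum.elim_inr, Matrix.cons_val_zero, hrate] using hd (Sum.inr 0)
    have hall : ∀ k, phiForm d k / h28 a k = 0 := fun k => by
      by_cases hk : k = m; · rw [hk]; exact hdm
      have h := hd (Sum.inl (m, k))
      simp only [harow, Sum.elim_inl, if_pos (hm' k hk), sub_dotProduct, hrate] at h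
      linarith
    have h := eq_smul_sParam_of_forall_rate_eq hpos hall
    rwa [zero_smul] at h
  -- a feasible point: the normalised `δ₀`
  obtain ⟨g, hg⟩ : ∃ g : ℝ, g = phiForm δ₀ M / h28 a M - phiForm δ₀ m / h28 a m := ⟨_, rfl⟩
  have hgpos : 0 < g := by rw [hg]; exact sub_pos.mpr hmM'
  obtain ⟨x₁, hx₁⟩ : ∃ x₁ : Fin 8 → ℝ, x₁ = g⁻¹ • δ₀ + (-(g⁻¹ * (phiForm δ₀ m / h28 a m))) • sParam a :=
    ⟨_, rfl⟩
  have hx₁r : ∀ k, phiForm x₁ k / h28 a k = g⁻¹ * (phiForm δ₀ k / h28 a k - phiForm δ₀ m / h28 a m) := fun k => by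
    rw [hx₁, rate_smul_add_smul_sParam hpos]; ring
  have hx₁feas : ∀ i, arow i ⬝ᵥ x₁ ≤ brow i := by
    refine feas_of x₁ (fun k l hkl => ?_) ?_ ?_
    · rw [hx₁r, hx₁r]
      exact mul_le_mul_of_nonneg_left (by linarith) (inv_pos.mpr hgpos).le
    · rw [hx₁r, sub_self, mul_zero]
    · rw [hx₁r, ← hg, inv_mul_cancel₀ hgpos.ne']
  -- the objective is bounded on the section (rates in `[0,1]`)
  have hbound : ∀ y : Fin 8 → ℝ, (∀ i, arow i ⬝ᵥ y ≤ brow i) → c ⬝ᵥ y ≤ ∑ k, |W k| := by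
    intro y hy
    obtain ⟨hyc, hym, hyM⟩ := of_feas y hy
    rw [hobj]
    refine Finset.sum_le_sum fun k _ => ?_
    have h01 := hsand y hyc k
    have h0 : 0 ≤ phiForm y k / h28 a k := by linarith [h01.1]
    have h1 : phiForm y k / h28 a k ≤ 1 := by linarith [h01.2]
    calc W k * (phiForm y k / h28 a k) ≤ |W k| * (phiForm y k / h28 a k) :=
          mul_le_mul_of_nonneg_right (le_abs_self _) h0
      _ ≤ |W k| := mul_le_of_le_one_right (abs_nonneg _) h1
  -- attainment (LP duality, Cor. 7.1g) and a basic optimum solution (§8.5 (23))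
  obtain ⟨xs, hxs, hxsmax⟩ := Literature.Analysis.Convex.LPDuality.exists_isMaxOn_of_forall_le (𝕜 := ℝ)
    (arow : Matrix ((Fin 28 × Fin 28) ⊕ Fin 4) (Fin 8) ℝ) brow c ⟨x₁, fun i => hx₁feas i⟩
    (fun y hy => hbound y fun i => hy i)
  obtain ⟨x, hx, hcx, hdet⟩ :=
    Literature.Analysis.Convex.BasicOptimumSolution.exists_optimum_determined_by_tight_rows arow brow c hA
      (x₀ := xs) (fun i => hxs i) (fun y hy => hxsmax y fun i => hy i)
  obtain ⟨hxc, hxm, hxM⟩ := of_feas x hx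
  refine ⟨x, refines_of_forall_rate_le hgen hxc, fun k => ?_, ⟨m, M, hxm, hxM⟩,
    ⟨⟨m, M, ?_⟩, fun d hd => ?_⟩, fun y hy m' M' hmM' => ?_⟩
  · have h := hsand x hxc k
    rw [hxm] at h; rw [hxM] at h
    exact h
  · rw [hxm, hxM]; exact zero_ne_one
  · -- rigidity: subtract the components along `x` and `s(a)`, the tight rows kill the rest
    obtain ⟨α, hα⟩ : ∃ α : ℝ, α = phiForm d M / h28 a M - phiForm d m / h28 a m := ⟨_, rfl⟩
    obtain ⟨β, hβ⟩ : ∃ β : ℝ, β = phiForm d m / h28 a m := ⟨_, rfl⟩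
    have hd'r : ∀ k, phiForm (d + (-α) • x + (-β) • sParam a) k / h28 a k =
        phiForm d k / h28 a k - α * (phiForm x k / h28 a k) - β := fun k => by
      rw [add_assoc, phiForm_add, add_div, rate_smul_add_smul_sParam hpos]; ring
    have hd' : d + (-α) • x + (-β) • sParam a = 0 := by
      refine hdet _ fun i hi => ?_
      rcases i with ⟨k, l⟩ | j
      · simp only [harow, hbrow, Sum.elim_inl] at hi ⊢
        split_ifs at hi ⊢ with hkl
        · rw [sub_dotProduct, hrate, hrate, sub_eq_zero] at hi
          rw [sub_dotProduct, hrate, hrate, hd'r, hd'r, hd k l hi, hi, sub_self]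
        · rw [zero_dotProduct]
      · have t0 : arow (Sum.inr 0) ⬝ᵥ (d + (-α) • x + (-β) • sParam a) = 0 := by
          simp only [harow, Sum.elim_inr, Matrix.cons_val_zero, hrate, hd'r, hxm]
          rw [hβ]; ring
        have t1 : arow (Sum.inr 1) ⬝ᵥ (d + (-α) • x + (-β) • sParam a) = 0 := by
          simp only [harow, Sum.elim_inr, Matrix.cons_val_one, Matrix.cons_val_zero, neg_dotProduct, hrate, hd'r,
            hxm]
          rw [hβ]; ring
        have t2 : arow (Sum.inr 2) ⬝ᵥ (d + (-α) • x + (-β) • sParam a) = 0 := by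
          simp only [harow, Sum.elim_inr, Matrix.cons_val_two, Matrix.tail_cons, Matrix.head_cons, sub_dotProduct,
            hrate, hd'r, hxm, hxM]
          rw [hα]; ring
        have t3 : arow (Sum.inr 3) ⬝ᵥ (d + (-α) • x + (-β) • sParam a) = 0 := by
          simp only [harow, Sum.elim_inr, Matrix.cons_val_three, Matrix.tail_cons, Matrix.head_cons,
            sub_dotProduct, hrate, hd'r, hxm, hxM]
          rw [hα]; ring
        fin_cases j
        exacts [t0, t1, t2, t3]
    refine ⟨α, β, ?_⟩
    have := congrArg (fun v => v + α • x + β • sParam a) hd'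
    simp only [zero_add] at this
    rw [← this]
    ext p
    simp only [Pi.add_apply, Pi.smul_apply, smul_eq_mul, neg_mul]
    ring
  · -- maximality over the chamber, per unit spread: shift and scale `y` onto the section
    have hyle : ∀ k l : Fin 28, phiForm δ₀ k / h28 a k < phiForm δ₀ l / h28 a l →
        phiForm y k / h28 a k ≤ phiForm y l / h28 a l := fun k l hkl => rate_le_rate_of_refines hy hkl
    -- the slowest / fastest pair of `y` takes the same values as `δ₀`'s pair
    have hym : phiForm y m / h28 a m = phiForm y m' / h28 a m' := by
      refine le_antisymm ?_ (hmM' m).1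
      by_cases hk : m' = m; · rw [hk]
      exact hyle m m' (hm' m' hk)
    have hyM : phiForm y M / h28 a M = phiForm y M' / h28 a M' := by
      refine le_antisymm (hmM' M).2 ?_
      by_cases hk : M' = M; · rw [hk]
      exact hyle M' M (hM' M' hk)
    obtain ⟨s, hs⟩ : ∃ s : ℝ, s = phiForm y M' / h28 a M' - phiForm y m' / h28 a m' := ⟨_, rfl⟩
    have hs0 : 0 ≤ s := by rw [hs]; linarith [(hmM' m').2]
    rw [← hs]
    rcases hs0.eq_or_lt with h | h
    · -- spread `0`: all rates equal, `y` radial, both sides vanish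
      have hall : ∀ k, phiForm y k / h28 a k = phiForm y m' / h28 a m' := fun k =>
        le_antisymm (by linarith [(hmM' k).2]) (hmM' k).1
      have : ∑ k, W k * (phiForm y k / h28 a k) = 0 := by
        simp_rw [hall, ← Finset.sum_mul, hW, zero_mul]
      rw [this, ← h, mul_zero]
    · obtain ⟨y₁, hy₁⟩ : ∃ y₁ : Fin 8 → ℝ, y₁ = s⁻¹ • y + (-(s⁻¹ * (phiForm y m' / h28 a m'))) • sParam a :=
        ⟨_, rfl⟩
      have hy₁r : ∀ k, phiForm y₁ k / h28 a k = s⁻¹ * (phiForm y k / h28 a k - phiForm y m' / h28 a m') :=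
        fun k => by rw [hy₁, rate_smul_add_smul_sParam hpos]; ring
      have hy₁feas : ∀ i, arow i ⬝ᵥ y₁ ≤ brow i := by
        refine feas_of y₁ (fun k l hkl => ?_) ?_ ?_
        · rw [hy₁r, hy₁r]
          exact mul_le_mul_of_nonneg_left (by linarith [hyle k l hkl]) (inv_pos.mpr h).le
        · rw [hy₁r, hym, sub_self, mul_zero]
        · rw [hy₁r, hyM, ← hs, inv_mul_cancel₀ h.ne']
      have h1 := hxsmax y₁ hy₁feas
      rw [← hcx, hobj, hobj, hy₁, hval] at h1
      -- `s⁻¹·G(y) ≤ G(x)` ⇒ `G(y) ≤ G(x)·s`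
      have h2 := mul_le_mul_of_nonneg_left h1 h.le
      rw [← mul_assoc, mul_inv_cancel₀ h.ne', one_mul] at h2
      linarith

/-! ### Normalised rays: one per order pattern, finitely many -/

/-- **A NORMALISED RAY IS THE ONLY NORMALISED DISPLACEMENT WITH ITS ORDER PATTERN.** All 28 forms of `a` positive. If
`x` is normalised (rates in `[0, 1]`, one rate `0`, one rate `1`) with a rigid tie pattern, and `x'` is normalised with
the same strict order pattern (`r_k(x) < r_l(x) ⇔ r_k(x') < r_l(x')`), then `x' = x`: the common order gives the common
ties, so `x' = u•x + t•s(a)` (`ray_eq_smul_add_smul_of_ties`); the pair with rates `0 < 1` keeps its order, so `u > 0`;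
the rate `0` of `x` is the least rate of `x'`, namely `t = 0`, and the rate `1` of `x` is the largest, `u + t = 1`. WHY THE
ORDER PATTERN AND NOT THE TIE TYPE: the tie type alone does NOT determine a normalised ray — `x` and its opposite
`s(a) − x` (rates `1 − r_k(x)`) share their tie type and are both normalised rays; the strict order tells them apart. -/
theorem eq_of_normalised_of_same_order {a : Dir} (hpos : ∀ k, 0 < h28 a k) {x x' : Fin 8 → ℝ}
    (hx01 : ∀ k, 0 ≤ phiForm x k / h28 a k ∧ phiForm x k / h28 a k ≤ 1)
    (hxn : ∃ k l, phiForm x k / h28 a k = 0 ∧ phiForm x l / h28 a l = 1)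
    (hx : ∀ d : Fin 8 → ℝ, (∀ k l, phiForm x k / h28 a k = phiForm x l / h28 a l →
        phiForm d k / h28 a k = phiForm d l / h28 a l) → ∃ u t : ℝ, d = u • x + t • sParam a)
    (hx'01 : ∀ k, 0 ≤ phiForm x' k / h28 a k ∧ phiForm x' k / h28 a k ≤ 1)
    (hx'n : ∃ k l, phiForm x' k / h28 a k = 0 ∧ phiForm x' l / h28 a l = 1)
    (hsame : ∀ k l, phiForm x k / h28 a k < phiForm x l / h28 a l ↔
      phiForm x' k / h28 a k < phiForm x' l / h28 a l) :
    x' = x := by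
  obtain ⟨k₀, l₀, hk₀, hl₀⟩ := hxn
  have hties : ∀ k l, phiForm x k / h28 a k = phiForm x l / h28 a l →
      phiForm x' k / h28 a k = phiForm x' l / h28 a l := fun k l h => by
    rcases lt_trichotomy (phiForm x' k / h28 a k) (phiForm x' l / h28 a l) with h' | h' | h'
    · exact absurd ((hsame k l).mpr h') (by rw [h]; exact lt_irrefl _)
    · exact h'
    · exact absurd ((hsame l k).mpr h') (by rw [h]; exact lt_irrefl _)
  obtain ⟨u, t, -, rfl⟩ := ray_eq_smul_add_smul_of_ties hpos hx
    ⟨k₀, l₀, ne_of_lt ((hsame k₀ l₀).mp (by rw [hk₀, hl₀]; exact zero_lt_one))⟩ hties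
  -- read `u`, `t` off the pair `(k₀, l₀)` and the normalisation of `x'`
  have hr : ∀ k, phiForm (u • x + t • sParam a) k / h28 a k = u * (phiForm x k / h28 a k) + t :=
    rate_smul_add_smul_sParam hpos x u t
  have hu : 0 < u := by
    have h := (hsame k₀ l₀).mp (by rw [hk₀, hl₀]; exact zero_lt_one)
    rw [hr, hr, hk₀, hl₀] at h
    linarith
  obtain ⟨k₁, l₁, hk₁, hl₁⟩ := hx'n
  rw [hr] at hk₁ hl₁
  have ht0 : 0 ≤ t := by have := (hx'01 k₀).1; rw [hr, hk₀, mul_zero, zero_add] at this; exact this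
  have ht0' : t ≤ 0 := by nlinarith [(hx01 k₁).1]
  have ht : t = 0 := le_antisymm ht0' ht0
  have hu1 : u ≤ 1 := by have := (hx'01 l₀).2; rw [hr, hl₀, mul_one, ht, add_zero] at this; exact this
  have hu1' : 1 ≤ u := by rw [ht, add_zero] at hl₁; nlinarith [(hx01 l₁).2]
  have hu' : u = 1 := le_antisymm hu1 hu1'
  rw [hu', ht, one_smul, zero_smul, add_zero]

/-- **THE NORMALISED RAYS FORM A FINITE SET.** All 28 forms of `a` positive. There is a finite set `R` of displacements
whose members are EXACTLY the normalised rays of the rate arrangement (rates in `[0, 1]`, one rate `0`, one rate `1`, two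
distinct rates, rigid tie pattern): a normalised ray is determined by its strict order pattern
(`eq_of_normalised_of_same_order`), and there are finitely many patterns. No count is claimed. -/
theorem exists_finset_normalised_rays {a : Dir} (hpos : ∀ k, 0 < h28 a k) :
    ∃ R : Finset (Fin 8 → ℝ), ∀ x : Fin 8 → ℝ, x ∈ R ↔
      (∀ k, 0 ≤ phiForm x k / h28 a k ∧ phiForm x k / h28 a k ≤ 1) ∧
      (∃ k l, phiForm x k / h28 a k = 0 ∧ phiForm x l / h28 a l = 1) ∧
      ((∃ k l, phiForm x k / h28 a k ≠ phiForm x l / h28 a l) ∧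
        ∀ d : Fin 8 → ℝ, (∀ k l, phiForm x k / h28 a k = phiForm x l / h28 a l →
          phiForm d k / h28 a k = phiForm d l / h28 a l) → ∃ u t : ℝ, d = u • x + t • sParam a) := by
  classical
  obtain ⟨N, hN⟩ : ∃ N : Set (Fin 8 → ℝ), N = {x |
      (∀ k, 0 ≤ phiForm x k / h28 a k ∧ phiForm x k / h28 a k ≤ 1) ∧
      (∃ k l, phiForm x k / h28 a k = 0 ∧ phiForm x l / h28 a l = 1) ∧
      ((∃ k l, phiForm x k / h28 a k ≠ phiForm x l / h28 a l) ∧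
        ∀ d : Fin 8 → ℝ, (∀ k l, phiForm x k / h28 a k = phiForm x l / h28 a l →
          phiForm d k / h28 a k = phiForm d l / h28 a l) → ∃ u t : ℝ, d = u • x + t • sParam a)} := ⟨_, rfl⟩
  -- the order pattern is injective on normalised rays
  obtain ⟨op, hop⟩ : ∃ op : (Fin 8 → ℝ) → Fin 28 → Fin 28 → Bool, ∀ x k l,
      op x k l = decide (phiForm x k / h28 a k < phiForm x l / h28 a l) := ⟨_, fun _ _ _ => rfl⟩
  have hinj : Set.InjOn op N := by
    intro x hx x' hx' he
    rw [hN] at hx hx'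
    obtain ⟨hx01, hxn, -, hxrig⟩ := hx
    obtain ⟨hx'01, hx'n, -, -⟩ := hx'
    refine (eq_of_normalised_of_same_order hpos hx01 hxn hxrig hx'01 hx'n fun k l => ?_).symm
    have := congrFun (congrFun he k) l
    rwa [hop, hop, decide_eq_decide] at this
  have hfin : N.Finite := Set.Finite.of_finite_image (Set.toFinite _) hinj
  refine ⟨hfin.toFinset, fun x => ?_⟩
  rw [Set.Finite.mem_toFinset, hN]
  rfl

/-- **EVERY CHAMBER CONTAINS A NORMALISED RAY** (all 28 forms of `a` positive, `δ₀` generic; the case `W = 0` of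
`exists_normalised_ray_max_section`) — in particular the finite set of normalised rays is non-empty. -/
theorem exists_normalised_ray_refines {a : Dir} (hpos : ∀ k, 0 < h28 a k) {δ₀ : Fin 8 → ℝ}
    (hgen : ∀ k l : Fin 28, k ≠ l → phiForm δ₀ k / h28 a k ≠ phiForm δ₀ l / h28 a l) :
    ∃ x : Fin 8 → ℝ, (∀ k l : Fin 28, phiForm x k / h28 a k < phiForm x l / h28 a l →
        phiForm δ₀ k / h28 a k < phiForm δ₀ l / h28 a l) ∧
      (∀ k, 0 ≤ phiForm x k / h28 a k ∧ phiForm x k / h28 a k ≤ 1) ∧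
      (∃ k l, phiForm x k / h28 a k = 0 ∧ phiForm x l / h28 a l = 1) ∧
      ((∃ k l, phiForm x k / h28 a k ≠ phiForm x l / h28 a l) ∧
        ∀ d : Fin 8 → ℝ, (∀ k l, phiForm x k / h28 a k = phiForm x l / h28 a l →
          phiForm d k / h28 a k = phiForm d l / h28 a l) → ∃ u t : ℝ, d = u • x + t • sParam a) := by
  obtain ⟨x, hxref, hx01, hxn, hray, -⟩ :=
    exists_normalised_ray_max_section hpos hgen (W := fun _ => 0) (by simp)
  exact ⟨x, hxref, hx01, hxn, hray⟩

end Summit.KontsevichZagierPeriods.Zeta5Search.Barrier.ConeGamma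

end
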